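import Summits.BirchSwinnertonDyer.Rank1Residual.Additive.StrictSignedSelmer
import Summits.BirchSwinnertonDyer.Rank1Residual.Additive.CyclotomicTowerSignedLocalTraceTransitive
import Summits.BirchSwinnertonDyer.Rank1Residual.Additive.CyclotomicTowerSignedSelmer
import Literature.NumberTheory.EllipticCurves.IwasawaSelmerControlLocalizationProofs
import HarnessLib

/-!
# `Sel^{ε,str}(E/K_∞)` lies in the Selmer group CUT OUT BY LEVEL-`∞` LOCAL CONDITIONS: Kummer
# conditions restrict down the tower, and the strict signed local groups `E^{ε,str}(K_n·E)` increase
# with `n` (cell `b2b-bsdres`, CLASS-CLOSURE lane, class O10 — x1b GEN 35, class lead; file 45 of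
# the series: brick B2 of the GLOBAL count (C), part 2 — the inclusion `A₀ ⊆ A₀'`)

HONEST FRAMING (cell `b2b-bsdres`, run/shared/lean/b2b/bsd-rank1-residual/, verbatim in every
file): the goal of the cell is to DELETE the COMBINATION-SHAPED residual classes of the
Birch–Swinnerton-Dyer formula for ALL analytic-rank `≤ 1` elliptic curves over `ℚ` — "full BSD
formula for every rank `≤ 1` curve in class `C`" assembled STRICTLY from published theorems — so
that the rank-`≤ 1` remainder becomes exactly the CONSTRUCTION-SHAPED classes, which are TYPED
(missing-input `Prop`s), NOT attempted. This is not "finishing BSD". CLASS-CLOSURE lane: prove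
what is provable now; shrink each hard class to its core with data; no claim beyond stated classes;
research routes on CONSTRUCTION-SHAPED X12 / O10; census / instrument output = EVIDENCE / conjecture
items, NEVER a Literature fact; `RESIDUAL-MAP.md` marks change only by signed lines. THIS FILE:
TOOL THEOREMS ONLY over p17's vocabulary (`strictSignedLocalPointsOfEmb`, `strictSignedSelmerLayer`,
`strictSignedSelmerInfty`, file `StrictSignedSelmer.lean`) and the tree's Kummer condition
`localKummerOverOfEmb` (Kobayashi2003/SignedSelmer) — no definition, no named Literature fact, no
Summits-side fact `def … : Prop`, no `sorry`, axioms standard; nothing is booked; no label / mark /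
count / sub-cell moves; (C1_η), (C2_η-GZ), (C3_η) stay typed as filed; O10 stays OPEN /
CONSTRUCTION-SHAPED; nothing about `BSD(W, p)` of any pair is claimed.

## What (brick B2 of the GLOBAL count (C), x1b GEN 34 `HSUM-UNCONDITIONAL-x1b.md` §3b)

`Sel^{ε,str}(E/K_∞) := ⋃ₙ hₙ(Sel^{ε,str}(E/K_n))` (p17, Def. 2.1's direct limit) is a priori NOT
given by local conditions over `K_∞`. B2 compares `A₀ = h₀⁻¹(Sel^{ε,str}(E/K_∞))` with the group
`A₀'` of classes over `K` satisfying the LEVEL-`∞` local conditions: the classical ones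
(`h₀ y ∈ Sel_{p^∞}(E/K_∞)`, local conditions by definition, `selmerInfty = selmerGroupOver`) and,
at the model `E` of the place above `p` and all its conjugates, the Kummer condition cut out by
`E^{ε,str}(K_∞·E) := ⋃ₙ E^{ε,str}(K_n·E)`. This file proves the inclusion
**`Sel^{ε,str}(E/K_∞) ≤ Sel_{p^∞}(E/K_∞) ⊓ ⨅_σ conj_σ⁻¹(Kummer_∞(⋃ₙ E^{ε,str}(K_n·E)))`**
(`strictSignedSelmerInfty_le_inf_localKummer`, §3), hence `A₀ ⊆ A₀'`, from:

* §1 `resOfLe_mem_localKummerOverOfEmb`: the Kummer condition cut out by `A` is compatible with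
  restriction `H¹(H', E[p^∞]) → H¹(H, E[p^∞])` (`H ≤ H'`): the restricted class is represented by
  the restricted crossed homomorphism, with the same `Q` (`map_oneCocycleClass`);
* §2 `signedLocalPointsOfEmb_eq_towerSigned` (the tree's Def. 1.1 group over the `κ`-layers IS
  cc-typer-6's `towerSignedLocalPointsOfEmb` for the tower `n ↦ κ⁻¹(pⁿℤ_p)`: its `m = −1` clause
  `Tr_{n/0} P ∈ E(K_{−1,v})`, `K_{−1} = K_0 = K` here, is automatic), whence
  `signedLocalPointsOfEmb_mono` and **`strictSignedLocalPointsOfEmb_mono`**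
  (`E^{ε,str}(K_m·E) ≤ E^{ε,str}(K_n·E)` for `m ≤ n`: `Tr_{n/0} P = [K_n·E : K_m·E]·Tr_{m/0} P` stays
  torsion) and `mem_iSup_strictSignedLocalPointsOfEmb_iff` (the union is directed: a point of
  `⋃ₙ E^{ε,str}(K_n·E)` lies in one `E^{ε,str}(K_n·E)`) — used by part 3 for `A₀' ⊆ A₀`.

References: [Kobayashi2003] S. Kobayashi, Invent. Math. 152 (2003), Def. 1.1 (p. 2), §2 p. 4,
Def. 2.1 (p. 5), proof of Prop. 8.12 (p. 18: `C_ss(m_{n−2}) ⊆ C_ss(m_n)`); [GreenbergLNM1716]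
R. Greenberg, LNM 1716 (1999), §2 p. 71 and §3 pp. 85–86; [SerreGaloisCohomology1997] I.§2.4, I.§5.1.
-/

noncomputable section

open scoped Classical

universe u

namespace Summit.BirchSwinnertonDyer.Rank1Residual.Additive

open Literature.NumberTheory.EllipticCurves Literature.NumberTheory.GaloisRepresentations
  Literature.NumberTheory.EllipticCurves.Kobayashi2003 ZpExtension

/-! ## §1 The Kummer condition restricts down: `res (Kummer_{H'}(A)) ⊆ Kummer_H(A)` -/

section Kummer

variable {K : Type u} [Field K] (W : WeierstrassCurve K) (p : ℕ)
  {E : Type u} [Field E] [Algebra K E] (ι : AlgebraicClosure K →ₐ[K] AlgebraicClosure E)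

/-- **The Kummer local condition is compatible with restriction.** For `H ≤ H' ≤ Γ_K`, a
`K`-embedding `ι : K̄ → K̄_E` and `A ≤ E(K̄_E)`: if `c ∈ H¹(H', E[p^∞])` is represented by a crossed
homomorphism `φ` with `ι(φ(τ|_K̄)) = τQ − Q` on `Gal(K̄_E/L'_w)` and `pᵏQ ∈ A`, then `res c` is
represented by `φ|_H` (`map_oneCocycleClass`) with the same identity on the smaller group
`Gal(K̄_E/L_w) ≤ Gal(K̄_E/L'_w)` and the same `Q`, `k`. (The Kummer maps commute with restriction;
Greenberg, LNM 1716, §2 p. 71.) [cite: Kobayashi2003, Def. 1.1] [cite: GreenbergLNM1716, §2 p. 71] -/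
theorem resOfLe_mem_localKummerOverOfEmb {H H' : Subgroup (Field.absoluteGaloisGroup K)}
    (h : H ≤ H') (A : AddSubgroup (localPoints W E)) {c : W.subgroupH1 p H'}
    (hc : c ∈ localKummerOverOfEmb W p H' ι A) :
    W.resOfLe p h c ∈ localKummerOverOfEmb W p H ι A := by
  obtain ⟨φ, Q, k, rfl, hA, hτ⟩ := hc
  refine ⟨contOneCocycles.pullback (subgroupInclusion h)
      (resHomOfEquivariant (subgroupInclusion h) (AddMonoidHom.id (W.geomPrimaryTorsion p))
        (fun _ _ ↦ rfl)) φ, Q, k, ?_, hA, fun τ ↦ ?_⟩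
  · exact (map_oneCocycleClass _ (subgroupInclusion h)
      (resHomOfEquivariant (subgroupInclusion h) (AddMonoidHom.id (W.geomPrimaryTorsion p))
        (fun _ _ ↦ rfl)) φ).symm
  · exact hτ ⟨(τ : Field.absoluteGaloisGroup E), Subgroup.comap_mono h τ.2⟩

end Kummer

/-! ## §2 The strict signed local groups increase with the layer -/

section Local

variable {K : Type u} [Field K] {p : ℕ} [Fact p.Prime] (κ : ZpExtension K p)
  {E : Type u} [Field E] [Algebra K E] (ι : AlgebraicClosure K →ₐ[K] AlgebraicClosure E)
  (W : WeierstrassCurve K)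

/-- **Def. 1.1's group over the `κ`-layers IS cc-typer-6's tower group** for the tower
`n ↦ κ⁻¹(pⁿℤ_p)`: `signedLocalPointsOfEmb κ ι W ε n = towerSignedLocalPointsOfEmb (κ.layerSubgroup) ι W ε n`.
The extra `m = −1` clause of the tower group (`ε = −1`: `Tr_{n/0} P ∈ E(K_{−1,v})`,
`localFixedPointsOfEmb ι W ⊤`) is automatic here since `κ⁻¹(p⁰ℤ_p) = ⊤` (`layerSubgroup_zero`): a
trace to the bottom layer is a bottom-layer point (`localPairTraceOfEmb_mem_of_mem`).
[cite: Kobayashi2003, Def. 1.1 (p. 2) and §2 p. 4] -/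
theorem signedLocalPointsOfEmb_eq_towerSigned (ε : ℤˣ) (n : ℕ) :
    signedLocalPointsOfEmb κ ι W ε n = towerSignedLocalPointsOfEmb κ.layerSubgroup ι W ε n := by
  ext P
  rw [mem_signedLocalPointsOfEmb_iff, mem_towerSignedLocalPointsOfEmb_iff]
  constructor
  · rintro ⟨hP, hsgn⟩
    refine ⟨hP, hsgn, fun _ ↦ ?_⟩
    rw [show localFixedPointsOfEmb ι W (⊤ : Subgroup (Field.absoluteGaloisGroup K)) =
        localFixedPointsOfEmb ι W (κ.layerSubgroup 0) by rw [layerSubgroup_zero]]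
    exact localPairTraceOfEmb_mem_of_mem ι W hP
  · rintro ⟨hP, hsgn, -⟩
    exact ⟨hP, hsgn⟩

/-- **`E^ε(K_m·E) ≤ E^ε(K_n·E)` for `m ≤ n`** (Def. 1.1's groups over the `κ`-layers): cc-typer-6's
`towerSignedLocalPointsOfEmb_mono` (proof of Prop. 8.12, p. 18: "`C_ss(m_{n−2}) ⊆ C_ss(m_n)`") read
through `signedLocalPointsOfEmb_eq_towerSigned`. [cite: Kobayashi2003, Def. 1.1 and Prop. 8.12 (proof, p. 18)] -/
theorem signedLocalPointsOfEmb_mono (ε : ℤˣ) : Monotone (signedLocalPointsOfEmb κ ι W ε) := by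
  intro m n hmn
  rw [signedLocalPointsOfEmb_eq_towerSigned, signedLocalPointsOfEmb_eq_towerSigned]
  exact towerSignedLocalPointsOfEmb_mono κ.layerSubgroup ι W κ.layerSubgroup_antitone ε hmn

/-- **`E^{ε,str}(K_m·E) ≤ E^{ε,str}(K_n·E)` for `m ≤ n`** (p17's strict groups, Def. 2.1 with the
`m = −1` clause read as "`Tr_{n/0} P` is torsion"): the signed part by `signedLocalPointsOfEmb_mono`;
the clause because `Tr_{n/0} P = [K_n·E : K_m·E] · Tr_{m/0} P` for `P ∈ E(K_m·E)`
(`localPairTraceOfEmb_of_mem_mid`), and multiples of torsion points are torsion.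
[cite: Kobayashi2003, §2 p. 4 and Def. 2.1 (p. 5)] -/
theorem strictSignedLocalPointsOfEmb_mono (ε : ℤˣ) : Monotone (strictSignedLocalPointsOfEmb κ ι W ε) := by
  intro m n hmn P hP
  rw [mem_strictSignedLocalPointsOfEmb_iff] at hP ⊢
  obtain ⟨hPm, htor⟩ := hP
  refine ⟨signedLocalPointsOfEmb_mono κ ι W ε hmn hPm, fun hε ↦ ?_⟩
  have hfix : P ∈ localFixedPointsOfEmb ι W (κ.layerSubgroup m) := (signedLocalPointsOfEmb_le κ ι W ε m) hPm
  have htr : localTraceOfEmb κ ι W 0 n P =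
      ((localSubgroupOfEmb (κ.layerSubgroup n) ι).subgroupOf
          (localSubgroupOfEmb (κ.layerSubgroup m) ι)).index • localTraceOfEmb κ ι W 0 m P := by
    rw [localTraceOfEmb_eq_localPairTraceOfEmb, localTraceOfEmb_eq_localPairTraceOfEmb]
    exact localPairTraceOfEmb_of_mem_mid κ.layerSubgroup ι W κ.layerSubgroup_antitone (Nat.zero_le m)
      hmn hfix
  rw [htr]
  exact AddSubgroup.nsmul_mem _ (htor hε) _

/-- **The union `⋃ₙ E^{ε,str}(K_n·E)` is directed**: a point of `⨆ₙ E^{ε,str}(K_n·E)` lies in a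
single `E^{ε,str}(K_n·E)` (Mathlib `AddSubgroup.mem_iSup_of_directed` for the monotone family).
[cite: Kobayashi2003, §2 p. 4 (E^±(K_{∞}) as the union over the layers)] -/
theorem mem_iSup_strictSignedLocalPointsOfEmb_iff (ε : ℤˣ) (P : localPoints W E) :
    P ∈ (⨆ n, strictSignedLocalPointsOfEmb κ ι W ε n) ↔ ∃ n, P ∈ strictSignedLocalPointsOfEmb κ ι W ε n :=
  AddSubgroup.mem_iSup_of_directed (strictSignedLocalPointsOfEmb_mono κ ι W ε).directed_le

/-- `E^{ε,str}(K_n·E) ≤ ⋃ₘ E^{ε,str}(K_m·E)`. [cite: Kobayashi2003, §2 p. 4] -/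
theorem strictSignedLocalPointsOfEmb_le_iSup (ε : ℤˣ) (n : ℕ) :
    strictSignedLocalPointsOfEmb κ ι W ε n ≤ ⨆ m, strictSignedLocalPointsOfEmb κ ι W ε m :=
  le_iSup (strictSignedLocalPointsOfEmb κ ι W ε) n

end Local

/-! ## §3 `Sel^{ε,str}(E/K_∞)` satisfies the level-`∞` local conditions -/

section Selmer

variable {K : Type u} [Field K] [NumberField K] (W : WeierstrassCurve K) {p : ℕ} [Fact p.Prime]
  (κ : ZpExtension K p) (E : Type u) [Field E] [Algebra K E] (ε : ℤˣ)

/-- **A restricted strict signed class satisfies the level-`∞` Kummer condition at every conjugate.**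
For `c ∈ Sel^{ε,str}(E/K_n)` and `σ ∈ Γ_K`: `conj_σ (hₙ c) = hₙ (conj_σ c)` (`layerToInfty_conjH1`),
`conj_σ c ∈ Sel^{ε,str}(E/K_n)` (`conjH1_mem_strictSignedSelmerLayer`) lies in the Kummer condition
cut out by `E^{ε,str}(K_n·E)` at level `n`, which restricts to the one at level `∞` (§1) and is
monotone in the point group (`E^{ε,str}(K_n·E) ≤ ⋃ₘ E^{ε,str}(K_m·E)`).
[cite: Kobayashi2003, Def. 2.1 (p. 5)] -/
theorem conjH1_layerToInfty_mem_localKummerOverOfEmb_iSup {n : ℕ}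
    {c : W.subgroupH1 p (κ.layerSubgroup n)} (hc : c ∈ strictSignedSelmerLayer W κ E ε n)
    (σ : Field.absoluteGaloisGroup K) :
    W.conjH1 p κ.kerSubgroup σ (W.layerToInfty κ n c) ∈
      localKummerOverOfEmb W p κ.kerSubgroup (closureEmb (K := K) E)
        (⨆ m, strictSignedLocalPoints κ E W ε m) := by
  rw [← W.layerToInfty_conjH1 κ σ c]
  exact localKummerOverOfEmb_mono (strictSignedLocalPointsOfEmb_le_iSup κ (closureEmb (K := K) E) W ε n)
    (resOfLe_mem_localKummerOverOfEmb W p (closureEmb (K := K) E) (κ.kerSubgroup_le_layerSubgroup n) _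
      (mem_localKummerOverOfEmb_of_mem_strictSignedSelmerLayer W κ E ε n
        (conjH1_mem_strictSignedSelmerLayer W κ E ε n σ hc)))

/-- **`Sel^{ε,str}(E/K_∞)` is cut out (from above) by the level-`∞` local conditions**:
`Sel^{ε,str}(E/K_∞) ≤ Sel_{p^∞}(E/K_∞) ⊓ ⨅_σ conj_σ⁻¹ Kummer_∞(⋃ₙ E^{ε,str}(K_n·E))` — every
generator `hₙ(c)`, `c ∈ Sel^{ε,str}(E/K_n)`, lies in `Sel_{p^∞}(E/K_∞)`
(`strictSignedSelmerInfty_le_selmerInfty`) and satisfies the Kummer condition at the model `E` and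
all its `Γ_K`-conjugates (`conjH1_layerToInfty_mem_localKummerOverOfEmb_iSup`). With
`A₀ = h₀⁻¹(Sel^{ε,str}(E/K_∞))` this is the inclusion `A₀ ⊆ A₀'` of brick B2; the reverse inclusion
(for classes coming from `K`) is part 3 of the series. [cite: Kobayashi2003, Def. 2.1 (p. 5)]
[cite: GreenbergLNM1716, §3 pp. 85–86] -/
theorem strictSignedSelmerInfty_le_inf_localKummer :
    strictSignedSelmerInfty W κ E ε ≤ W.selmerInfty κ ⊓
      ⨅ σ : Field.absoluteGaloisGroup K,
        (localKummerOverOfEmb W p κ.kerSubgroup (closureEmb (K := K) E)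
            (⨆ m, strictSignedLocalPoints κ E W ε m)).comap (W.conjH1 p κ.kerSubgroup σ) := by
  refine le_inf (strictSignedSelmerInfty_le_selmerInfty W κ E ε) (iSup_le fun n ↦ ?_)
  rintro _ ⟨c, hc, rfl⟩
  simp only [AddSubgroup.mem_iInf, AddSubgroup.mem_comap]
  exact fun σ ↦ conjH1_layerToInfty_mem_localKummerOverOfEmb_iSup W κ E ε hc σ

/-- Membership form of `strictSignedSelmerInfty_le_inf_localKummer`: an element of
`Sel^{ε,str}(E/K_∞)` lies in `Sel_{p^∞}(E/K_∞)` and satisfies the level-`∞` strict signed Kummer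
condition at every conjugate of the chosen embedding. [cite: Kobayashi2003, Def. 2.1 (p. 5)] -/
theorem mem_selmerInfty_and_forall_conjH1_mem_of_mem_strictSignedSelmerInfty
    {s : W.subgroupH1 p κ.kerSubgroup} (hs : s ∈ strictSignedSelmerInfty W κ E ε) :
    s ∈ W.selmerInfty κ ∧ ∀ σ : Field.absoluteGaloisGroup K,
      W.conjH1 p κ.kerSubgroup σ s ∈
        localKummerOverOfEmb W p κ.kerSubgroup (closureEmb (K := K) E)
          (⨆ m, strictSignedLocalPoints κ E W ε m) := by
  have h := strictSignedSelmerInfty_le_inf_localKummer W κ E ε hs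
  simp only [AddSubgroup.mem_inf, AddSubgroup.mem_iInf, AddSubgroup.mem_comap] at h
  exact h

/-- **`A₀ ⊆ A₀'` at every layer**: if `hₙ y ∈ Sel^{ε,str}(E/K_∞)` then `hₙ y` satisfies the
level-`∞` local conditions (classical everywhere; strict signed Kummer at `E` and its conjugates).
[cite: Kobayashi2003, Def. 2.1 (p. 5)] [cite: GreenbergLNM1716, §3 pp. 85–86] -/
theorem comap_layerToInfty_strictSignedSelmerInfty_le (n : ℕ) :
    (strictSignedSelmerInfty W κ E ε).comap (W.layerToInfty κ n) ≤
      (W.selmerInfty κ ⊓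
        ⨅ σ : Field.absoluteGaloisGroup K,
          (localKummerOverOfEmb W p κ.kerSubgroup (closureEmb (K := K) E)
              (⨆ m, strictSignedLocalPoints κ E W ε m)).comap (W.conjH1 p κ.kerSubgroup σ)).comap
        (W.layerToInfty κ n) :=
  AddSubgroup.comap_mono (strictSignedSelmerInfty_le_inf_localKummer W κ E ε)

end Selmer

end Summit.BirchSwinnertonDyer.Rank1Residual.Additive

end
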